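import Literature.NumberTheory.Automorphic.AdelicGroupDataGLnProofs
import HarnessLib

/-!
# `G(K)` is discrete in `G(𝔸_K)` for matric data; `Kˣ` is discrete in `𝔸_Kˣ`; the bare predicate is not a theorem
(Borel, *Some finiteness properties of adele groups over number fields*, Publ. Math. IHÉS 16
(1963), §1.2)

Sibling proof file (theorems only, no `sorry`, no new definitions) of
`Literature.NumberTheory.Automorphic.AdelicGroupData`, written for the fact-discharge pass over
the predicate `AdelicGroupData.IsDiscreteRational`
(`𝒢.IsDiscreteRational := DiscreteTopology 𝒢.arithmeticSubgroup`, "`G(K)` is discrete in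
`G(𝔸_K)`").

**What the source prints.** Borel (1963), §1.2 (p. 7), for an *algebraic matric group* `G` of
degree `n` over the number field `k` (a `k`-closed subgroup of `GL_n`) with adele group
`G_A ⊆ ∏_v G_{k_v}`: "To any element `a ∈ G_k` corresponds an adele of `G`, all of whose
components are equal to `a`, called a principal adele of `G`. When viewed as subgroups of `G_A`,
the groups `G_k`, `G_{𝔬(S)}`, `G_𝔬` will, unless otherwise said, be identified with groups of
principal adeles. They are discrete …".  (The docstring of `IsDiscreteRational` points to §5,
which is the finiteness-of-volume paragraph; the discreteness statement is the one recalled in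
§1.2 from Weil's *Adeles and algebraic groups*, Ch. I.)

**What the tree declares.** `AdelicGroupData K` is an *abstract* hypothesis structure (any
topological group `Adelic`, any group `Rational`, any homomorphism `toAdelic`), and
`IsDiscreteRational` is — as its own docstring says — "an axiom-free predicate on the abstract
datum".  Its universal closure is **false**: `not_forall_isDiscreteRational` below exhibits the
datum `G(K) = G(𝔸_K) = ℝ` (identity embedding), whose "arithmetic subgroup" is all of the
non-discrete group `ℝ`.  So there is no `IsDiscreteRational_holds`; the predicate is a genuine
hypothesis, discharged instance by instance.

**What is proved here (the printed statement, in the language of the datum).**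

* `AdelicGroupData.isDiscreteRational_of_continuous_injective` — **Borel §1.2 for matric data**:
  if the adelic group of `𝒢` maps by a continuous injective homomorphism `ι` into
  `GL_n(𝔸_K)` (Mathlib `Matrix.GeneralLinearGroup` over `NumberField.AdeleRing (𝓞 K) K`, units
  topology) carrying rational points to rational points (`ι (G(K)) ⊆ GL_n(K)`), then `G(K)` is
  discrete in `G(𝔸_K)`.  This is exactly the situation of an algebraic matric group
  `G ⊆ GL_n` over `K` (`G_A ↪ GL_n(A)` is a topological embedding and `G_k = G_A ∩ GL_n(k)`).
  Proof: `GL_n(K)` is discrete in `GL_n(𝔸_K)` (`gl_isDiscreteRational_holds`, sibling file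
  `AdelicGroupDataGLnProofs`: `K` discrete in `𝔸_K` plus continuity of the matrix entries), and a
  discrete topology pulls back along a continuous injection (Mathlib
  `DiscreteTopology.of_continuous_injective`).
* `AdelicGroupData.gl1_isDiscreteRational_holds` — the honest instance `gl1 K`: **`Kˣ` is
  discrete in the idele group `𝔸_Kˣ`** (Borel's "in the same way as the multiplicative group `k*`
  … is imbedded in the idele group `I_k`", loc. cit. introduction; Cassels–Fröhlich II §16 Lemma).
  This is `discreteTopology_principalIdeles` of `IdeleClassGroupProofs`, whose subgroup
  `principalIdeles K` is definitionally `(gl1 K).arithmeticSubgroup`.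
* `AdelicGroupData.not_forall_isDiscreteRational` — the witness that the bare predicate is not
  a theorem of the abstract datum.

Together with the tree's `gl_isDiscreteRational_holds n K` (`GL_n`) and
`AdelicGroupData.units_isDiscreteRational_holds` (`Dˣ ⊆ D_𝔸ˣ` for a finite-dimensional
`K`-algebra `D`, `QuaternionAlgebraAdelicDiscreteProofs`), every honest instance of
`AdelicGroupData` in the tree has its `IsDiscreteRational` discharged.

## References

* A. Borel, *Some finiteness properties of adele groups over number fields*, Publ. Math. IHÉS 16
  (1963), 5–30; §1.2 ("They are discrete"), Introduction (p. 5). [Borel1963]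
* J. W. S. Cassels, A. Fröhlich (eds.), *Algebraic Number Theory* (1967), Ch. II §14 Theorem,
  §16 Lemma. [CasselsFrohlichANT1967]
-/

noncomputable section

open scoped MatrixGroups
open NumberField IsDedekindDomain
open _root_.Topology

universe u

namespace Literature.NumberTheory.Automorphic

namespace AdelicGroupData

/-! ### Borel §1.2: rational points of matric data are discrete -/

section Matric

variable {K : Type} [Field K] [NumberField K]

/-- **`G(K)` is discrete in `G(𝔸_K)` for an algebraic matric group** (Borel 1963, §1.2: the
principal adeles `G_k ⊆ G_A` "are discrete"), in the language of the abstract datum: if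
`ι : G(𝔸_K) →* GL_n(𝔸_K)` is a continuous injective homomorphism with `ι (G(K)) ⊆ GL_n(K)`
(as for any `K`-closed subgroup `G ⊆ GL_n`, `G_A ↪ GL_n(A)`, `G_k = G_A ∩ GL_n(k)`), then the
arithmetic subgroup `G(K)` of `G(𝔸_K)` carries the discrete topology.  Reduction to
`GL_n(K) ⊆ GL_n(𝔸_K)` (`gl_isDiscreteRational_holds`) along the continuous injection `ι`
(Mathlib `DiscreteTopology.of_continuous_injective`). [cite: Borel1963, §1.2] -/
theorem isDiscreteRational_of_continuous_injective (𝒢 : AdelicGroupData.{u} K) {n : ℕ}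
    (ι : 𝒢.Adelic →* GL (Fin n) (AdeleRing (𝓞 K) K)) (hc : Continuous ι)
    (hinj : Function.Injective ι)
    (hrat : ∀ γ : 𝒢.Rational, ι (𝒢.toAdelic γ) ∈ (gl n K).arithmeticSubgroup) :
    𝒢.IsDiscreteRational := by
  haveI : DiscreteTopology ↥(gl n K).arithmeticSubgroup := gl_isDiscreteRational_holds n K
  -- the restriction of `ι` to the arithmetic subgroups `G(K) → GL_n(K)`
  have hmem : ∀ x : 𝒢.arithmeticSubgroup, ι x.1 ∈ (gl n K).arithmeticSubgroup := by
    rintro ⟨_, γ, rfl⟩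
    exact hrat γ
  let f : 𝒢.arithmeticSubgroup → (gl n K).arithmeticSubgroup := fun x => ⟨ι x.1, hmem x⟩
  have hf : Continuous f := (hc.comp continuous_subtype_val).subtype_mk _
  have hfi : Function.Injective f := fun x y hxy =>
    Subtype.ext (hinj (congrArg Subtype.val hxy))
  exact DiscreteTopology.of_continuous_injective hf hfi

/-- **The bare predicate `IsDiscreteRational` is not a theorem of the abstract datum**: its
universal closure over all `AdelicGroupData K` is false.  Witness: the datum with
`G(K) = G(𝔸_K) = G(K_v) = ℝ` (the additive reals, written multiplicatively), identity maps and
trivial `A_G`; its arithmetic subgroup is all of `ℝ`, and `ℝ` is not discrete (`{0}` is not open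
in a nontrivially normed field, Mathlib `not_isOpen_singleton`).  Hence the discreteness of
`G(K)` is discharged instance by instance (`gl_isDiscreteRational_holds`,
`gl1_isDiscreteRational_holds`, `units_isDiscreteRational_holds`,
`isDiscreteRational_of_continuous_injective`). [folklore] -/
theorem not_forall_isDiscreteRational :
    ¬ ∀ 𝒢 : AdelicGroupData.{0} K, 𝒢.IsDiscreteRational := by
  intro h
  let 𝒢 : AdelicGroupData.{0} K :=
    { Rational := Multiplicative ℝ
      Adelic := Multiplicative ℝ
      toAdelic := MonoidHom.id _
      Local := fun _ => Multiplicative ℝ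
      toLocal := fun _ => MonoidHom.id _
      continuous_toLocal := fun _ => continuous_id
      center' := ⊥
      center'_le := bot_le }
  have hd : DiscreteTopology ↥𝒢.arithmeticSubgroup := h 𝒢
  -- `ℝ → G(K) ⊆ G(𝔸_K)`, `x ↦ x`, is continuous and injective, so `ℝ` would be discrete
  have hmem : ∀ x : Multiplicative ℝ, x ∈ 𝒢.arithmeticSubgroup := fun x => ⟨x, rfl⟩
  have hf : Continuous fun x : Multiplicative ℝ => (⟨x, hmem x⟩ : 𝒢.arithmeticSubgroup) :=
    continuous_id.subtype_mk _
  have hR : DiscreteTopology (Multiplicative ℝ) :=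
    DiscreteTopology.of_continuous_injective hf fun x y hxy => congrArg Subtype.val hxy
  exact not_isOpen_singleton (0 : ℝ) (discreteTopology_iff_isOpen_singleton_one.1 hR)

end Matric

/-! ### The instance `GL₁`: `Kˣ` is discrete in `𝔸_Kˣ` -/

section GLOne

variable (K : Type) [Field K] [NumberField K]

/-- **`Kˣ` is a discrete subgroup of the idele group `𝔸_Kˣ`** — discharge of
`IsDiscreteRational` for the honest instance `gl1 K` (`Rational = Kˣ`, `Adelic = 𝔸_Kˣ` with the
units topology).  Borel (1963), Introduction and §1.2 (`G = GL₁`: "`G_k` … imbedded as a discrete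
subgroup, in the same way as … `k*` … in the idele group `I_k`"); Cassels–Fröhlich II §16 Lemma.
The tree's `discreteTopology_principalIdeles` (`IdeleClassGroupProofs`), whose subgroup of
principal ideles is definitionally `(gl1 K).arithmeticSubgroup`. [cite: Borel1963, §1.2] -/
theorem gl1_isDiscreteRational_holds : (gl1 K).IsDiscreteRational :=
  discreteTopology_principalIdeles K

/-- `GL₁(K)` is discrete in `GL₁(𝔸_K)` also through the general matric criterion: the instance
`gl 1 K` itself, with `ι = id` (sanity check of `isDiscreteRational_of_continuous_injective`;
Borel 1963 §1.2). [cite: Borel1963, §1.2] -/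
theorem gl_isDiscreteRational_of_matric (n : ℕ) : (gl n K).IsDiscreteRational :=
  isDiscreteRational_of_continuous_injective (gl n K) (MonoidHom.id _) continuous_id
    (fun _ _ h => h) fun γ => ⟨γ, rfl⟩

end GLOne

end AdelicGroupData

end Literature.NumberTheory.Automorphic
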